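import Literature.NumberTheory.EllipticCurves.CasselsTateSelmerKolyvaginValue
import Literature.NumberTheory.EllipticCurves.CasselsTateLevelPrimary
import Literature.NumberTheory.EllipticCurves.HeegnerPointsKolyvaginEulerSystem
import Literature.NumberTheory.EllipticCurves.SelmerTorsionOperatorLocalKernel
import HarnessLib

/-!
# The COUPLED Cassels–Tate telescope, XV′: the (T-L2) VALUE CUT in the 𝒪-LINE (PAIR) form — hT^κ's
# Cassels–Tate value clause REDUCED to McCallum's LOCAL leaf stated for the PAIR (`t`, `w_S t`)
# (supersedes XV `…CoupledTelescopeValueCut` p709315 for discharge; planner D646/D648, k-ty1 g13 CHECK-FIRST (a))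

Crux `UpperOffV0HSYPlus` (stmt-BirchSwinnertonDyer-19804); display hT^κ = `…TailFourKappa` (p704180),
value clauses l.153–188: `P_X ⟨2^j c_X(ℓm), _⟩ ⟨t, _⟩ ≠ 0` where `P_X` is the PAIR
`(B₂ (ι₂ ·) (ι₂ ·), B₂ (ι₂ ·) (w (ι₂ ·)))` — the sesquilinear refinement (memo (P6)).  File XV reduced
the clause to the INDIVIDUAL `ℚ⁄ℤ`-valued local leaf «`D.localTerm … ≠ 0` for the first-case datum over
`t`», which k-ty1 g13 showed to be SELF-DEFEATING at `p = 2` inert (its hypotheses are stable under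
`t ↦ a t + b w_S t`, its conclusion is not; `Tr(1/2) ≡ 0` over `𝒪⁄2^M`) — planner D646.  THIS file is
the repair of record: the same reduction with the local leaf in the 𝒪-LINE form (T-L2)′ «NOT BOTH
first-case local terms — over `t` and over `w_S t` — vanish», using BOTH components of `P_X`
(`hP`, `hP₂`), the Selmer-level operator `w_S = resH1Hom id fn hfn` over the isogeny `φ` (`hcoe`,
`hwSel`, `hwS`) and the Ш-level `w₂` over the same `φ` (`hw₂`) — all clauses of the one-φ / curve
packages (p708199 / XVI) — and k-ty1 #35 `resH1Hom_id_mem_torsionLocalKer_of_hasLocalPointsMaps`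
(`w_S t` dies at the places over `m` when `t` does).  No first-case datum is constructed, so XV's `hfix`
is gone.  OUTPUT UNCHANGED: the hCTV_X clause VERBATIM-SHAPED.

* `valueClause_of_localLeafPair` — (iii)'s value clause for (X, X', cX, cX', par, P) from hcSel, htriv,
  hKol and the 𝒪-line LOCAL LEAF (T-L2)′ (McCallum Lemma 5.3 at level `κ` in its `p = 2`-correct
  form; rows'/K-lane).  Proof: `P z t = 0` ⇒ both coordinates vanish ⇒ `exists_bridge_ctLevelPairing`
  + `ctLevelPairing_pullback_ne_zero_iff_localTerm_kolyvagin` (`.mpr`, twice) ⇒ every first-case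
  local term over `t` and over `w_S t` vanishes ⇒ (T-L2)′ gives `False` (seam = k-ty1 g13's scratch
  `ValueCutPair.scratch` fa9fe24913871ef5, `hι₂w` derived here from `hw₂`/`hwS`/`hι₂`).

Theorem-only (no definition, no named fact); nothing asserted on 19804; no stub closed; X12.CMAtTwo
NOT proved; BSD not claimed for any curve.  Sources: McCallum 1991 §4 Lemma 4.3, Prop. 4.7, §5
Lemma 5.3, Thm. 5.4; Milne ADT I §6 Prop. 6.9; MEMO-bsd-cm-two §59, §64 (P2)(P5)(P6).
-/

-- every Summits module is named `Summit.<Summit>.<Problem>…`: the duplicated component is by design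
set_option linter.dupNamespace false
set_option autoImplicit false

noncomputable section

open scoped Classical AddSubgroup

open WeierstrassCurve Literature.NumberTheory.EllipticCurves Field NumberField IsDedekindDomain
  Literature.NumberTheory.GaloisRepresentations Literature.NumberTheory.GaloisCohomology
  Literature.NumberTheory.EllipticCurves.KolyvaginDescent
open Literature.NumberTheory.GaloisRepresentations.DiscreteGaloisModule (mu)

namespace Summit.BirchSwinnertonDyer.BirchSwinnertonDyer.Theorems.SylvesterTwoCoupledTelescope

section ValueCut

variable {K : Type} [Field K] [NumberField K] (X X' : WeierstrassCurve K) [X.IsElliptic]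

/-- **The (T-L2) VALUE CUT, 𝒪-LINE (PAIR) form** (module docstring): hT^κ's Cassels–Tate value clause
for the curve `X` (partner `X'`, parity `par`) from the (T-L1)-type leaves `hcSel`/`htriv`/`hKol` and the
𝒪-line LOCAL LEAF (T-L2)′, for the Selmer pull-back PAIR `P = (B₂ (ι₂ ·) (ι₂ ·), B₂ (ι₂ ·) (w₂ (ι₂ ·)))` of the
constructed level-`2^κ` pairing (`hB₂`, `hι₂`, `hP`, `hP₂`) and the Selmer-level `w_S` over the same `φ`
(`hcoe`, `hwSel`, `hwS`, `hw₂`).  McCallum: «the groups `E(K_λ)/p^M` and `H¹(K_λ, E)_{p^M}` pair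
non-trivially» — at `p = 2` inert only along the `𝒪`-line `{t, w_S t}` (memo (P6)), which is (T-L2)′.
[cite: McCallumLMS1991, §4 Prop. 4.7, §5 Lemma 5.3, Thm. 5.4 (proof)]
[cite: MilneADT2006, Ch. I §6, proof of Prop. 6.9] -/
theorem valueClause_of_localLeafPair (κ : ℕ)
    -- the Weil datum at level `4^κ`, the invariant family and Milne's inputs (cone-interim BINDERS)
    (e : geomTorsion X ((2 ^ κ * 2 ^ κ : ℕ) : ℤ) → geomTorsion X ((2 ^ κ * 2 ^ κ : ℕ) : ℤ) →
      AlgebraicClosure K)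
    (hμ : ∀ S T, e S T ^ (2 ^ κ * 2 ^ κ) = 1)
    (hadd₁ : ∀ S₁ S₂ T, e (S₁ + S₂) T = e S₁ T * e S₂ T)
    (hadd₂ : ∀ S T₁ T₂, e S (T₁ + T₂) = e S T₁ * e S T₂)
    (hgal : ∀ (σ : absoluteGaloisGroup K) (S T : geomTorsion X ((2 ^ κ * 2 ^ κ : ℕ) : ℤ)),
      σ • e S T = e (σ • S) (σ • T))
    (halt : ∀ T, e T T = 1) (inv : LocalInvariants K (2 ^ κ * 2 ^ κ))
    (hPT' : inv.SumInvLocalizationEqZero)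
    (hH3 : ∀ c : galoisCohomology (mu K (2 ^ κ * 2 ^ κ)) 3,
      (∀ v : Place K, galoisCohomology.localization (mu K (2 ^ κ * 2 ^ κ)) v 3 c = 0) → c = 0)
    (hfin : ∀ D : GeneralCaseData X (2 ^ κ) e hμ hadd₁ hadd₂ hgal, ∃ S : Finset (Place K),
      ∀ v ∉ S, D.localTerm inv v = 0)
    -- the constructed pairing on `Ш(X/K)[2^∞]`, its Selmer pull-back map, and the displayed `P`
    (hle : AddCommGroup.primaryComponent X.sha 2 ≤ (X.sha)[2 ^ κ])
    (B₂ : AddCommGroup.primaryComponent X.sha 2 →+ AddCommGroup.primaryComponent X.sha 2 →+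
      AddCircle (1 : ℚ))
    (hB₂ : ∀ a b, B₂ a b = ctLevelPairing X (2 ^ κ) e hμ hadd₁ hadd₂ hgal inv halt hPT' hH3 hfin
      ⟨a, hle a.2⟩ ⟨b, hle b.2⟩)
    (ι₂ : selmerGroup X ((2 ^ κ * 2 ^ κ : ℕ) : ℤ) →+ AddCommGroup.primaryComponent X.sha 2)
    (hι₂ : ∀ z, (((ι₂ z : AddCommGroup.primaryComponent X.sha 2) : X.sha) : X.galH1) =
      torsionH1ToH1 X ((2 ^ κ * 2 ^ κ : ℕ) : ℤ) z)
    (P : selmerGroup X ((2 ^ κ * 2 ^ κ : ℕ) : ℤ) →+ selmerGroup X ((2 ^ κ * 2 ^ κ : ℕ) : ℤ) →+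
      AddCircle (1 : ℚ) × AddCircle (1 : ℚ))
    (hP : ∀ z t, (P z t).1 = B₂ (ι₂ z) (ι₂ t))
    -- NEW ((IV)'s clauses): the Ш-level operator `w₂`, the second component of `P`, the Selmer-level
    -- operator `w_S := resH1Hom id fn hfn` over the isogeny `φ` with `w_S² + w_S + 1 = 0`, Selmer-stable,
    -- and `ι₂ ∘ w_S = w₂ ∘ ι₂`
    (w₂ : AddCommGroup.primaryComponent X.sha 2 →+ AddCommGroup.primaryComponent X.sha 2)
    (hP₂ : ∀ z t, (P z t).2 = B₂ (ι₂ z) (w₂ (ι₂ t)))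
    (fn : geomTorsion X ((2 ^ κ * 2 ^ κ : ℕ) : ℤ) →+ geomTorsion X ((2 ^ κ * 2 ^ κ : ℕ) : ℤ))
    (hfn : ∀ (g : absoluteGaloisGroup K) (Q : geomTorsion X ((2 ^ κ * 2 ^ κ : ℕ) : ℤ)),
      fn (ContinuousMonoidHom.id _ g • Q) = g • fn Q)
    (φ : Isogeny X X)
    (hcoe : ∀ Q : geomTorsion X ((2 ^ κ * 2 ^ κ : ℕ) : ℤ),
      ((fn Q : geomTorsion X ((2 ^ κ * 2 ^ κ : ℕ) : ℤ)) : geomPoints X) = φ Q)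
    (hwSel : ∀ c ∈ selmerGroup X ((2 ^ κ * 2 ^ κ : ℕ) : ℤ),
      resH1Hom (ContinuousMonoidHom.id _) fn hfn c ∈ selmerGroup X ((2 ^ κ * 2 ^ κ : ℕ) : ℤ))
    (hw₂ : ∀ x, (((w₂ x : AddCommGroup.primaryComponent X.sha 2) : X.sha) : X.galH1) =
      galH1Map φ.toAddMonoidHom φ.equivariant ((x : X.sha) : X.galH1))
    (hwS : ∀ c, torsionH1ToH1 X ((2 ^ κ * 2 ^ κ : ℕ) : ℤ) (resH1Hom (ContinuousMonoidHom.id _) fn hfn c) =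
      galH1Map φ.toAddMonoidHom φ.equivariant (torsionH1ToH1 X ((2 ^ κ * 2 ^ κ : ℕ) : ℤ) c))
    -- the Kolyvagin predicate, the parity, the classes of `X` and of the partner `X'`
    (Kol : ℕ → Prop) (hKol : ∀ ℓ, Kol ℓ → ℓ.Prime ∧ (Ideal.span {(ℓ : 𝓞 K)}).IsPrime)
    (par : ℕ → Prop)
    (cX : ℕ → galH1Torsion X ((2 ^ κ * 2 ^ κ : ℕ) : ℤ))
    (cX' : ℕ → galH1Torsion X' ((2 ^ κ * 2 ^ κ : ℕ) : ℤ))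
    -- (T-L1)-type leaves: Selmer away from `λ` and `m` (McCallum 4.3); `X[4^κ] ⊆ X(K_q)` at Kolyvagin `q`
    (hcSel : ∀ ℓ m : ℕ, Kol ℓ → KolSupp Kol (ℓ * m) → ¬ ℓ ∣ m →
      ∀ v₀ : HeightOneSpectrum (𝓞 K), (ℓ : 𝓞 K) ∈ v₀.asIdeal →
      ∀ v : Place K, v ≠ Sum.inr v₀ →
        (∀ q : HeightOneSpectrum (𝓞 K), (∃ r ∈ m.primeFactors, (r : 𝓞 K) ∈ q.asIdeal) →
          v ≠ Sum.inr q) →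
        cX (ℓ * m) ∈ selmerLocalKer X (Place.Completion v) ((2 ^ κ * 2 ^ κ : ℕ) : ℤ))
    (htriv : ∀ r : ℕ, Kol r → ∀ q : HeightOneSpectrum (𝓞 K), (r : 𝓞 K) ∈ q.asIdeal →
      ∀ (g : absoluteGaloisGroup (Place.Completion (Sum.inr q : Place K)))
        (Q : geomTorsion X ((2 ^ κ * 2 ^ κ : ℕ) : ℤ)),
        absGaloisRestrict K (Place.Completion (Sum.inr q : Place K)) g • Q = Q)
    -- (`hfix : X(K)[2^κ] = 0` of (III) is no longer needed: no first-case datum is CONSTRUCTED here)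
    -- THE LOCAL LEAF (McCallum Lemma 5.3 at level `κ`)
    (hloc : ∀ ℓ m : ℕ, Kol ℓ → KolSupp Kol (ℓ * m) → ¬ ℓ ∣ m → par m →
      ∀ (j N' a b : ℕ) (t : galH1Torsion X ((2 ^ κ * 2 ^ κ : ℕ) : ℤ))
        (ht : t ∈ selmerGroup X ((2 ^ κ * 2 ^ κ : ℕ) : ℤ))
        (hz : ((2 : ℤ) ^ j) • cX (ℓ * m) ∈ selmerGroup X ((2 ^ κ * 2 ^ κ : ℕ) : ℤ)),
        ((2 : ℤ) ^ N') • t = 0 →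
        (∀ q ∈ m.primeFactors, ∀ v : HeightOneSpectrum (𝓞 K), (q : 𝓞 K) ∈ v.asIdeal →
          t ∈ X.torsionLocalKer (v.adicCompletion K) ((2 ^ κ * 2 ^ κ : ℕ) : ℤ)) →
        κ ≤ j → N' ≤ κ → N' ≤ j → a + b + 1 = N' →
        (∀ v : HeightOneSpectrum (𝓞 K), (ℓ : 𝓞 K) ∈ v.asIdeal →
          ((2 : ℤ) ^ (a + (j - N'))) • cX' m ∉
            X'.torsionLocalKer (v.adicCompletion K) ((2 ^ κ * 2 ^ κ : ℕ) : ℤ)) →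
        (∀ v : HeightOneSpectrum (𝓞 K), (ℓ : 𝓞 K) ∈ v.asIdeal → ((2 : ℤ) ^ b) • t ∉
          X.torsionLocalKer (v.adicCompletion K) ((2 ^ κ * 2 ^ κ : ℕ) : ℤ)) →
        ∀ v₀ : HeightOneSpectrum (𝓞 K), (ℓ : 𝓞 K) ∈ v₀.asIdeal →
        -- (T-L2)′: the 𝒪-LINE (PAIR) form — NOT both first-case local terms (over `t`, over `w_S t`) vanish
        (∀ D : FirstCaseData X (2 ^ κ), D.b₁ = ((2 : ℤ) ^ (j - κ)) • cX (ℓ * m) →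
          galoisCohomology.map (inclKD X (2 ^ κ) (2 ^ κ)) 1 D.b' = t →
          D.localTerm e hμ hadd₁ hadd₂ hgal inv (Sum.inr v₀) = 0) →
        (∀ D : FirstCaseData X (2 ^ κ), D.b₁ = ((2 : ℤ) ^ (j - κ)) • cX (ℓ * m) →
          galoisCohomology.map (inclKD X (2 ^ κ) (2 ^ κ)) 1 D.b' =
            resH1Hom (ContinuousMonoidHom.id _) fn hfn t →
          D.localTerm e hμ hadd₁ hadd₂ hgal inv (Sum.inr v₀) = 0) →
        False) :
    ∀ ℓ m : ℕ, Kol ℓ → KolSupp Kol (ℓ * m) → ¬ ℓ ∣ m → par m →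
      ∀ (j N' a b : ℕ) (t : galH1Torsion X ((2 ^ κ * 2 ^ κ : ℕ) : ℤ))
        (ht : t ∈ selmerGroup X ((2 ^ κ * 2 ^ κ : ℕ) : ℤ))
        (hz : ((2 : ℤ) ^ j) • cX (ℓ * m) ∈ selmerGroup X ((2 ^ κ * 2 ^ κ : ℕ) : ℤ)),
        ((2 : ℤ) ^ N') • t = 0 →
        (∀ q ∈ m.primeFactors, ∀ v : HeightOneSpectrum (𝓞 K), (q : 𝓞 K) ∈ v.asIdeal →
          t ∈ X.torsionLocalKer (v.adicCompletion K) ((2 ^ κ * 2 ^ κ : ℕ) : ℤ)) →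
        κ ≤ j → N' ≤ κ → N' ≤ j → a + b + 1 = N' →
        (∀ v : HeightOneSpectrum (𝓞 K), (ℓ : 𝓞 K) ∈ v.asIdeal →
          ((2 : ℤ) ^ (a + (j - N'))) • cX' m ∉
            X'.torsionLocalKer (v.adicCompletion K) ((2 ^ κ * 2 ^ κ : ℕ) : ℤ)) →
        (∀ v : HeightOneSpectrum (𝓞 K), (ℓ : 𝓞 K) ∈ v.asIdeal → ((2 : ℤ) ^ b) • t ∉
          X.torsionLocalKer (v.adicCompletion K) ((2 ^ κ * 2 ^ κ : ℕ) : ℤ)) →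
        P ⟨_, hz⟩ ⟨t, ht⟩ ≠ 0 := by
  intro ℓ m hℓ hsupp hndvd hpar j N' a b t ht hz hN' hq hκj hN'κ hN'j hab hX' hX h0
  -- ### `ι₂ ∘ w_S = w₂ ∘ ι₂` on Selmer classes (both lie over `galH1Map φ`, and `↑↑` is injective)
  have hι₂w : ∀ (u : galH1Torsion X ((2 ^ κ * 2 ^ κ : ℕ) : ℤ))
      (hu : u ∈ selmerGroup X ((2 ^ κ * 2 ^ κ : ℕ) : ℤ)),
      ι₂ ⟨resH1Hom (ContinuousMonoidHom.id _) fn hfn u, hwSel u hu⟩ = w₂ (ι₂ ⟨u, hu⟩) := fun u hu ↦ by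
    apply Subtype.ext
    apply Subtype.ext
    rw [hι₂, hw₂, hι₂]
    exact hwS u
  -- ### the place `λ = (ℓ)` of `K`
  obtain ⟨hℓp, hℓP⟩ := hKol ℓ hℓ
  have hℓ0 : (ℓ : 𝓞 K) ≠ 0 := by exact_mod_cast hℓp.ne_zero
  let v₀ : HeightOneSpectrum (𝓞 K) :=
    ⟨Ideal.span {(ℓ : 𝓞 K)}, hℓP, by rwa [Ne, Ideal.span_singleton_eq_bot]⟩
  have hv₀ : (ℓ : 𝓞 K) ∈ v₀.asIdeal := Ideal.mem_span_singleton_self _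
  -- ### the bridge `B₂ (ι₂ z) (ι₂ t) = ctLevelPairing … (ι z) (ι t)`
  obtain ⟨ι, hι, -, hbridge⟩ := exists_bridge_ctLevelPairing X (2 ^ κ) e hμ hadd₁ hadd₂ hgal inv halt
    hPT' hH3 hfin hle B₂ hB₂ ι₂ hι₂
  -- ### the first-case datum of the Kolyvagin pair: `z = 2^κ • (2^{j-κ} • c)`, `2^κ • t = 0`
  have hz' : ((⟨_, hz⟩ : selmerGroup X ((2 ^ κ * 2 ^ κ : ℕ) : ℤ)) :
      galH1Torsion X ((2 ^ κ * 2 ^ κ : ℕ) : ℤ)) =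
      ((2 ^ κ : ℕ) : ℤ) • ((2 : ℤ) ^ (j - κ)) • cX (ℓ * m) := by
    change ((2 : ℤ) ^ j) • cX (ℓ * m) = _
    rw [smul_smul]
    congr 1
    push_cast
    rw [← pow_add, Nat.add_sub_cancel' hκj]
  -- ### the partner class `t' := w_S t` and its hypotheses (Selmer, vanishing at the places over `m`)
  have ht' : resH1Hom (ContinuousMonoidHom.id _) fn hfn t ∈ selmerGroup X ((2 ^ κ * 2 ^ κ : ℕ) : ℤ) :=
    hwSel t ht
  have hq' : ∀ q ∈ m.primeFactors, ∀ v : HeightOneSpectrum (𝓞 K), (q : 𝓞 K) ∈ v.asIdeal →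
      resH1Hom (ContinuousMonoidHom.id _) fn hfn t ∈
        X.torsionLocalKer (v.adicCompletion K) ((2 ^ κ * 2 ^ κ : ℕ) : ℤ) := fun q hq' v hv ↦
    resH1Hom_id_mem_torsionLocalKer_of_hasLocalPointsMaps _ _ fn hfn φ.toAddMonoidHom hcoe
      φ.hasLocalPointsMaps_toAddMonoidHom (hq q hq' v hv)
  -- ### the value theorem's local hypotheses at the places over `m`
  have hc : ∀ v : Place K, v ≠ Sum.inr v₀ →
      (∀ q ∈ {q : HeightOneSpectrum (𝓞 K) | ∃ r ∈ m.primeFactors, (r : 𝓞 K) ∈ q.asIdeal},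
        v ≠ Sum.inr q) →
      cX (ℓ * m) ∈ selmerLocalKer X (Place.Completion v) ((2 ^ κ * 2 ^ κ : ℕ) : ℤ) :=
    fun v hv hT ↦ hcSel ℓ m hℓ hsupp hndvd v₀ hv₀ v hv fun q hq' ↦ hT q hq'
  have hk : (2 ^ κ * 2 ^ κ : ℕ) ≠ 0 := mul_ne_zero (pow_ne_zero κ two_ne_zero)
    (pow_ne_zero κ two_ne_zero)
  have htT : ∀ (u : galH1Torsion X ((2 ^ κ * 2 ^ κ : ℕ) : ℤ)),
      (∀ q ∈ m.primeFactors, ∀ v : HeightOneSpectrum (𝓞 K), (q : 𝓞 K) ∈ v.asIdeal →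
        u ∈ X.torsionLocalKer (v.adicCompletion K) ((2 ^ κ * 2 ^ κ : ℕ) : ℤ)) →
      ∀ q ∈ {q : HeightOneSpectrum (𝓞 K) | ∃ r ∈ m.primeFactors, (r : 𝓞 K) ∈ q.asIdeal},
      galoisCohomology.res (X.torsionGaloisModule ((2 ^ κ * 2 ^ κ : ℕ) : ℤ))
        (Place.Completion (Sum.inr q : Place K)) 1 u = 0 := by
    intro u hu q hq'
    obtain ⟨r, hr, hrq⟩ := hq'
    -- `char K_q = 0` (the tree's theorem `charZero_placeCompletion`, as an instance for this call only)
    haveI := charZero_placeCompletion (Sum.inr q : Place K)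
    exact (mem_torsionLocalKer_iff_res_eq_zero X (Place.Completion (Sum.inr q : Place K)) hk u).mp
      (hu r hr q hrq)
  have htrivT : ∀ q ∈ {q : HeightOneSpectrum (𝓞 K) | ∃ r ∈ m.primeFactors, (r : 𝓞 K) ∈ q.asIdeal},
      ∀ (g : absoluteGaloisGroup (Place.Completion (Sum.inr q : Place K)))
        (Q : geomTorsion X ((2 ^ κ * 2 ^ κ : ℕ) : ℤ)),
        absGaloisRestrict K (Place.Completion (Sum.inr q : Place K)) g • Q = Q := by
    intro q hq' g Q
    obtain ⟨r, hr, hrq⟩ := hq'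
    have hr' : r ∈ (ℓ * m).primeFactors := by
      obtain ⟨hrp, hrm, -⟩ := Nat.mem_primeFactors.mp hr
      exact Nat.mem_primeFactors.mpr ⟨hrp, dvd_mul_of_dvd_right hrm ℓ, hsupp.1.ne_zero⟩
    exact htriv r (hsupp.2 r hr') q hrq g Q
  -- ### both components of `P z t` vanish
  have h1 : (P ⟨_, hz⟩ ⟨t, ht⟩).1 = 0 := by rw [h0, Prod.fst_zero]
  have h2 : (P ⟨_, hz⟩ ⟨t, ht⟩).2 = 0 := by rw [h0, Prod.snd_zero]
  rw [hP, hbridge] at h1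
  rw [hP₂, ← hι₂w t ht, hbridge] at h2
  -- ### McCallum Prop. 4.7 on the constructed pairing, `.mp` twice, into (T-L2)′
  refine hloc ℓ m hℓ hsupp hndvd hpar j N' a b t ht hz hN' hq hκj hN'κ hN'j hab hX' hX v₀ hv₀
    (fun D hD₁ hDt ↦ ?_) (fun D hD₁ hDt ↦ ?_)
  · by_contra hne
    exact (ctLevelPairing_pullback_ne_zero_iff_localTerm_kolyvagin e hμ hadd₁ hadd₂ hgal inv halt
      hPT' hH3 hfin ι hι ⟨_, hz⟩ ⟨t, ht⟩ (cX (ℓ * m)) ((2 : ℤ) ^ (j - κ)) hz' v₀ _ hc (htT t hq)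
      htrivT D hD₁ hDt).mpr hne h1
  · by_contra hne
    exact (ctLevelPairing_pullback_ne_zero_iff_localTerm_kolyvagin e hμ hadd₁ hadd₂ hgal inv halt
      hPT' hH3 hfin ι hι ⟨_, hz⟩ ⟨_, ht'⟩ (cX (ℓ * m)) ((2 : ℤ) ^ (j - κ)) hz' v₀ _ hc (htT _ hq')
      htrivT D hD₁ hDt).mpr hne h2

end ValueCut

end Summit.BirchSwinnertonDyer.BirchSwinnertonDyer.Theorems.SylvesterTwoCoupledTelescope

end
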